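import Summits.BirchSwinnertonDyer.BirchSwinnertonDyer.Theorems.EdixhovenFibreFiveSevenLTwistTransferWitnessIrrCore2

/-!
# The TRANSFER WITNESS for every curve with irreducible `E[p]`, `p ∈ {5, 7}` — PROVED (route
# `EdixhovenFibreFiveSeven`, crux TDS57 / KP57, AKR crux #7; `--supports`; ROAD A′ part 10)

Cell `pub/bsd-wall` (D-0145 line `route-BirchSwinnertonDyer-EdixhovenFibreFiveSeven`), seat `bsd-line-edix-p3`
(prover). THEOREMS ONLY (no definition, no named fact, no `sorry`); route-free. BSD is not proved by this file.

`exists_galois_transfer_of_irr`: for `W/ℚ` elliptic with `E[p]` irreducible (`p ∈ {5,7}`) there is `σ ∈ Γ_ℚ` with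
`χ_{4p}(σ) ∈ {2p + 3, −(2p + 3)}` (both classes give `ℓ*` a non-residue and `ℓ ≢ 1 (mod p)`) and `ρ̄_{E,p}(σ)`
without eigenvalue `±1` — the abstract `false_of_bad` (`…WitnessIrrCore2`) instantiated with a frame diagonalising
complex conjugation, `H = Gal(ℚ̄/ℚ(μ_{4p}))`, `ζ` with `χ_{4p}(ζ) = 2p + 3` (Weil pairing: `det ρ̄(ζ) = 3`) and
the units of `ℤ/4p` being `⟨2p + 3, −1⟩`. Hence **`transferWitness`**: the hypothesis `hW` of
`LTwistTransfer.twistDegreeStepFiveSeven_of_kato_of_transferWitness` (p594464) holds for every globally minimal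
`V₀` with `Irr V₀ p`, `p ∈ {5,7}` — by `transferWitness_of_galois` (p595624, Chebotarev).

References: [Serre1972] §2; [SilvermanAEC2009] III.7, V.2.3.1; [TateGCFT1967] §2.4.
-/

set_option autoImplicit false
-- the Theorems directory repeats the summit name (sibling precedent `SignedBaseChangeAssembly.lean`)
set_option linter.dupNamespace false

noncomputable section

open scoped Classical MatrixGroups commutatorElement

open WeierstrassCurve NumberField IsDedekindDomain Field Matrix
  Literature.NumberTheory.EllipticCurves Literature.NumberTheory.GaloisRepresentations
  Literature.NumberTheory.EllipticCurves.Rank1Residual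
  Literature.NumberTheory.EllipticCurves.DokchitserDokchitser2012

namespace Summit.BirchSwinnertonDyer.BirchSwinnertonDyer.Theorems.LTwistTransfer

/-! ### §1 Eigenvalue criterion and the second class `−(2p+3)` -/

/-- A `2 × 2` matrix `M` with `det M − ε·tr M + 1 ≠ 0` (`ε = ±1`) has no eigenvector for `ε`:
`det(M − ε) = det M − ε tr M + ε²`. [folklore] -/
theorem eq_zero_of_mulVec_eq_sign {p : ℕ} [Fact p.Prime] {M : Matrix (Fin 2) (Fin 2) (ZMod p)} {ε : ZMod p}
    (hε : ε = 1 ∨ ε = -1) (hne : M.det - ε * (M 0 0 + M 1 1) + 1 ≠ 0) {x : Fin 2 → ZMod p}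
    (hx : M.mulVec x = ε • x) : x = 0 := by
  by_contra hx0
  have h0 : (M - ε • (1 : Matrix (Fin 2) (Fin 2) (ZMod p))).mulVec x = 0 := by
    rw [Matrix.sub_mulVec, hx, Matrix.smul_mulVec, Matrix.one_mulVec, sub_self]
  have hdet0 : (M - ε • (1 : Matrix (Fin 2) (Fin 2) (ZMod p))).det = 0 :=
    (Matrix.exists_mulVec_eq_zero_iff).mp ⟨x, hx0, h0⟩
  rw [Matrix.det_fin_two] at hne hdet0
  simp only [Matrix.sub_apply, Matrix.smul_apply, Matrix.one_apply_eq,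
    Matrix.one_apply_ne (show (0 : Fin 2) ≠ 1 by decide),
    Matrix.one_apply_ne (show (1 : Fin 2) ≠ 0 by decide), smul_eq_mul, mul_one, mul_zero, sub_zero] at hdet0
  have hε2 : ε ^ 2 = 1 := by rcases hε with rfl | rfl <;> ring
  exact hne (by linear_combination hdet0 - hε2)

/-- For `p ∈ {5, 7}` and `ℓ ≡ −(2p + 3) (mod 4p)`: `ℓ ≡ 3 (mod 4)`, so `ℓ* = −ℓ ≡ 3 (mod p)` is a non-residue,
and `ℓ ≡ −3 ≢ 1 (mod p)`. [folklore] -/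
theorem transferClass_facts_neg {p : ℕ} [Fact p.Prime] (hp57 : p = 5 ∨ p = 7) {ℓ : ℕ}
    (hℓ : (ℓ : ZMod (4 * p)) = -((2 * p + 3 : ℕ) : ZMod (4 * p))) :
    ¬ IsSquare ((((-1 : ℤ) ^ (ℓ / 2) * ℓ : ℤ)) : ZMod p) ∧ ¬ (p : ℤ) ∣ (ℓ : ℤ) - 1 := by
  haveI : NeZero p := ⟨(Fact.out : p.Prime).ne_zero⟩
  have hp2 : 2 ≤ p := (Fact.out : p.Prime).two_le
  have hℓ' : (ℓ : ZMod (4 * p)) = ((2 * p - 3 : ℕ) : ZMod (4 * p)) := by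
    rw [hℓ, eq_comm, ← sub_eq_zero, sub_neg_eq_add, ← Nat.cast_add,
      show 2 * p - 3 + (2 * p + 3) = 4 * p by omega, ZMod.natCast_self]
  have hmod : ℓ ≡ 2 * p - 3 [MOD 4 * p] := (ZMod.natCast_eq_natCast_iff _ _ _).mp hℓ'
  have h4 : ℓ % 4 = 3 := by
    have := (hmod.of_mul_right p : ℓ ≡ 2 * p - 3 [MOD 4])
    unfold Nat.ModEq at this
    rcases hp57 with rfl | rfl <;> simpa using this
  have hmp : ℓ % p = (p - 3) % p := by
    have := (hmod.of_mul_left 4 : ℓ ≡ 2 * p - 3 [MOD p])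
    unfold Nat.ModEq at this
    rw [this, show 2 * p - 3 = p - 3 + p by omega, Nat.add_mod_right]
  have hodd : Odd (ℓ / 2) := ⟨ℓ / 4, by omega⟩
  have hstar : ((-1 : ℤ) ^ (ℓ / 2) * ℓ : ℤ) = -ℓ := by rw [hodd.neg_one_pow]; ring
  have hℓp : (ℓ : ZMod p) = -3 := by
    have : (ℓ : ZMod p) = ((p - 3 : ℕ) : ZMod p) := (ZMod.natCast_eq_natCast_iff' ℓ (p - 3) p).mpr hmp
    rw [this, Nat.cast_sub (by omega), ZMod.natCast_self, zero_sub, Nat.cast_ofNat]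
  refine ⟨?_, ?_⟩
  · rw [hstar, Int.cast_neg, Int.cast_natCast, hℓp, neg_neg]
    rcases hp57 with rfl | rfl
    · exact not_isSquare_three_zmod_five
    · exact not_isSquare_three_zmod_seven
  · rw [← ZMod.intCast_zmod_eq_zero_iff_dvd]
    push_cast
    rw [hℓp, show (-3 : ZMod p) - 1 = -((4 : ℕ) : ZMod p) by norm_num]
    exact neg_ne_zero.mpr (natCast_zmod_ne_zero_of_lt (by norm_num) (by rcases hp57 with rfl | rfl <;> norm_num))

/-! ### §2 The Galois element for irreducible `E[p]` -/

/-- **The Galois element for a curve with irreducible `E[p]`, `p ∈ {5, 7}`.** Some `σ ∈ Γ_ℚ` has `χ_{4p}(σ)` in a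
good class (every `ℓ ≡ χ_{4p}(σ) (mod 4p)` has `ℓ*` a non-residue mod `p` and `ℓ ≢ 1 (mod p)`) and `ρ̄_{E,p}(σ)`
without eigenvalue `±1`: `σ = ζ h` or `σ = ζ c₀ h` (`h ∈ Gal(ℚ̄/ℚ(μ_{4p}))`) by `false_of_bad`.
[cite: Serre1972, §2.6 (subgroups of GL₂(𝔽_p))] [cite: SilvermanCSS1997, Ch. II §7 Proposition and §8] -/
theorem exists_galois_transfer_of_irr (W : WeierstrassCurve ℚ) [W.IsElliptic] (p : ℕ) [Fact p.Prime]
    (hp57 : p = 5 ∨ p = 7) (hirr : W.HasIrreducibleModPGaloisRep p) :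
    ∃ σ : absoluteGaloisGroup ℚ,
      (∀ ℓ : ℕ, ((ℓ : ZMod (4 * p)) = (modNCyclotomicCharacter ℚ (4 * p) σ : ZMod (4 * p))) →
        ¬ IsSquare ((((-1 : ℤ) ^ (ℓ / 2) * ℓ : ℤ)) : ZMod p) ∧ ¬ (p : ℤ) ∣ (ℓ : ℤ) - 1) ∧
      (∀ P : geomTorsion W p, σ • P = P → P = 0) ∧
      (∀ P : geomTorsion W p, σ • P = -P → P = 0) := by
  have hp : p.Prime := Fact.out
  haveI : NeZero p := ⟨hp.ne_zero⟩
  haveI : NeZero (4 * p) := ⟨mul_ne_zero (by norm_num) hp.ne_zero⟩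
  haveI : NeZero ((4 * p : ℕ) : ℚ) := NeZero.charZero
  haveI : NeZero (p : ℚ) := NeZero.charZero
  have hp2 : p ≠ 2 := by rcases hp57 with rfl | rfl <;> norm_num
  -- complex conjugation and an adapted frame
  obtain ⟨c₀, hc₀⟩ := exists_isComplexConjugation (Rat.castHom ℝ)
  obtain ⟨e, hC⟩ := exists_frame_conj_diag W p hp2 hc₀
  set ρ := rhoMat W e with hρ
  have hρv : ∀ (g : absoluteGaloisGroup ℚ) (T : geomTorsion W p), e (g • T) = (ρ g).mulVec (e T) :=
    fun g T ↦ rhoMat_mulVec W e g T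
  -- the subgroup `H = Gal(ℚ̄/ℚ(μ_{4p})) = ker χ_{4p}`
  set χ := modNCyclotomicCharacter ℚ (4 * p) with hχ
  set H : Subgroup (absoluteGaloisGroup ℚ) := rootsOfUnityFixer ℚ (4 * p) with hHdef
  have hHker : ∀ g, g ∈ H ↔ χ g = 1 := fun g ↦ by
    rw [hHdef, rootsOfUnityFixer_eq_ker, MonoidHom.mem_ker]
  have hHn : ∀ g : absoluteGaloisGroup ℚ, ∀ h ∈ H, g * h * g⁻¹ ∈ H := by
    intro g h hh
    rw [hHker] at hh ⊢
    rw [map_mul, map_mul, hh, mul_one, map_inv, mul_inv_cancel]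
  have hHc : ∀ g₁ g₂ : absoluteGaloisGroup ℚ, g₁ * g₂ * g₁⁻¹ * g₂⁻¹ ∈ H := by
    intro g₁ g₂
    rw [← commutatorElement_def]
    exact commutator_le_rootsOfUnityFixer ℚ (4 * p)
      (Subgroup.commutator_mem_commutator (Subgroup.mem_top g₁) (Subgroup.mem_top g₂))
  have hdetH : ∀ h ∈ H, (ρ h).det = 1 := fun h hh ↦
    NonEisensteinWitness.det_eq_one_of_mem_rootsOfUnityFixer W p (dvd_mul_left p 4) e hh (hρv h)
  -- the class element `ζ`
  set a₀ : ℕ := 2 * p + 3 with ha₀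
  have hcop : a₀.Coprime (4 * p) := by
    rw [ha₀]; rcases hp57 with rfl | rfl <;> decide
  obtain ⟨ζ, hζ⟩ := modNCyclotomicCharacter_rat_surjective (4 * p) (ZMod.unitOfCoprime a₀ hcop)
  have hζval : ((χ ζ : (ZMod (4 * p))ˣ) : ZMod (4 * p)) = (a₀ : ZMod (4 * p)) := by
    rw [hχ, hζ, ZMod.coe_unitOfCoprime]
  have hdetz : (ρ ζ).det = 3 := by
    rw [det_eq_modPCyclotomicCharacterZMod_of_exists_weilPairing W p (exists_weilPairing_holds W p) e ζ
      (ρ ζ) (hρv ζ), modP_eq_mod4p_val, ← hχ, hζval, ZMod.val_natCast, ha₀,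
      Nat.mod_eq_of_lt (by have := hp.two_le; omega : 2 * p + 3 < 4 * p)]
    push_cast
    rw [ZMod.natCast_self, mul_zero, zero_add]
  have hχc : ((χ c₀ : (ZMod (4 * p))ˣ) : ZMod (4 * p)) = -1 :=
    modNCyclotomicCharacter_of_isComplexConjugation (N := 4 * p) hc₀
  -- `G = ⋃ ζ^a c₀^b H`
  have hgen : ∀ g : absoluteGaloisGroup ℚ, ∃ (a b : ℕ) (h : absoluteGaloisGroup ℚ),
      h ∈ H ∧ g = ζ ^ a * c₀ ^ b * h := by
    intro g
    obtain ⟨a, b, hab⟩ := exists_pow_mul_neg_one_pow hp57 (χ g)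
    refine ⟨a, b, (ζ ^ a * c₀ ^ b)⁻¹ * g, ?_, (mul_inv_cancel_left _ _).symm⟩
    rw [hHker, map_mul, map_inv, inv_mul_eq_one]
    apply Units.ext
    rw [map_mul, map_pow, map_pow, Units.val_mul, Units.val_pow_eq_pow_val, Units.val_pow_eq_pow_val,
      hζval, hχc, hab]
  obtain ⟨g₁, hg₁⟩ := exists_apply_one_zero_ne_zero W p hirr e
  obtain ⟨g₂, hg₂⟩ := exists_apply_zero_one_ne_zero W p hirr e
  -- the good element, from `false_of_bad`
  have key : (∃ h ∈ H, (ρ ζ * ρ h) 0 0 + (ρ ζ * ρ h) 1 1 ≠ 4 ∧ (ρ ζ * ρ h) 0 0 + (ρ ζ * ρ h) 1 1 ≠ -4) ∨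
      (∃ h ∈ H, (ρ ζ * ρ c₀ * ρ h) 0 0 + (ρ ζ * ρ c₀ * ρ h) 1 1 ≠ 2 ∧
        (ρ ζ * ρ c₀ * ρ h) 0 0 + (ρ ζ * ρ c₀ * ρ h) 1 1 ≠ -2) := by
    by_contra hno
    push Not at hno
    obtain ⟨hnoA, hnoB⟩ := hno
    refine false_of_bad hp57 ρ H hHn hHc hdetH c₀ ζ hC hdetz hgen ⟨g₁, hg₁⟩ ?_ ?_ ⟨g₂, hg₂⟩
    · intro h hh
      by_cases h4 : (ρ ζ * ρ h) 0 0 + (ρ ζ * ρ h) 1 1 = 4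
      · exact Or.inl h4
      · exact Or.inr (hnoA h hh h4)
    · intro h hh
      by_cases h2' : (ρ ζ * ρ c₀ * ρ h) 0 0 + (ρ ζ * ρ c₀ * ρ h) 1 1 = 2
      · exact Or.inl h2'
      · exact Or.inr (hnoB h hh h2')
  have hex : ∀ P : geomTorsion W p, e P = 0 → P = 0 := fun P hP ↦ e.injective (by rw [hP, map_zero])
  have hdetC : (ρ c₀).det = -1 := by rw [hC, Matrix.det_fin_two_of]; ring
  rcases key with ⟨h, hh, ht4, ht4'⟩ | ⟨h, hh, ht2, ht2'⟩
  · refine ⟨ζ * h, ?_, ?_, ?_⟩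
    · intro ℓ hℓ
      rw [map_mul, (hHker h).mp hh, mul_one, hζval] at hℓ
      exact transferClass_facts hp57 hℓ
    · intro P hP
      refine hex P (eq_zero_of_mulVec_eq_sign (M := ρ ζ * ρ h) (Or.inl rfl) ?_ (x := e P) ?_)
      · rw [Matrix.det_mul, hdetz, hdetH h hh]
        intro h0; apply ht4; linear_combination -h0
      · rw [one_smul, ← map_mul, ← hρv, hP]
    · intro P hP
      refine hex P (eq_zero_of_mulVec_eq_sign (M := ρ ζ * ρ h) (Or.inr rfl) ?_ (x := e P) ?_)
      · rw [Matrix.det_mul, hdetz, hdetH h hh]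
        intro h0; apply ht4'; linear_combination h0
      · rw [neg_one_smul, ← map_mul, ← hρv, hP, map_neg]
  · refine ⟨ζ * c₀ * h, ?_, ?_, ?_⟩
    · intro ℓ hℓ
      rw [map_mul, map_mul, (hHker h).mp hh, mul_one, Units.val_mul, hζval, hχc, mul_neg_one] at hℓ
      exact transferClass_facts_neg hp57 hℓ
    · intro P hP
      refine hex P (eq_zero_of_mulVec_eq_sign (M := ρ ζ * ρ c₀ * ρ h) (Or.inl rfl) ?_ (x := e P) ?_)
      · rw [Matrix.det_mul, Matrix.det_mul, hdetz, hdetC, hdetH h hh]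
        intro h0; apply ht2'; linear_combination -h0
      · rw [one_smul, ← map_mul, ← map_mul, ← hρv, hP]
    · intro P hP
      refine hex P (eq_zero_of_mulVec_eq_sign (M := ρ ζ * ρ c₀ * ρ h) (Or.inr rfl) ?_ (x := e P) ?_)
      · rw [Matrix.det_mul, Matrix.det_mul, hdetz, hdetC, hdetH h hh]
        intro h0; apply ht2; linear_combination h0
      · rw [neg_one_smul, ← map_mul, ← map_mul, ← hρv, hP, map_neg]

/-- **The TRANSFER WITNESS — PROVED for every globally minimal `V₀/ℚ` with `E[p]` irreducible, `p ∈ {5, 7}`**: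
there is a prime `q ∤ 2 p N(V₀)` with `q*` a non-residue mod `p` and `p ∤ (q − 1)((q + 1)² − a_q(V₀)²)`. This is
the hypothesis `hW` of `LTwistTransfer.twistDegreeStepFiveSeven_of_kato_of_transferWitness` /
`…kpResidueManinUnitFiveSeven_of_kato_of_transferWitness` / `…maninFrameResidueProperR_of_kato_of_transferWitness`
(the additivity hypothesis there is not even needed). [cite: TateGCFT1967, §2.4 (Tchebotarev density theorem)]
[cite: Serre1972, §2.6 (subgroups of GL₂(𝔽_p))] [cite: SilvermanAEC2009, V.2.3.1, VII.3.1(b)] -/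
theorem transferWitness (p : ℕ) [Fact p.Prime] (V₀ : WeierstrassCurve ℚ) [V₀.IsElliptic] [V₀.IsGloballyMinimal]
    (hp57 : p = 5 ∨ p = 7) (hirr : Irr V₀ p) :
    ∃ q : ℕ, q.Prime ∧ q ≠ 2 ∧ q ≠ p ∧ ¬ q ∣ V₀.conductorNorm ℤ ∧
      ¬ IsSquare ((((-1 : ℤ) ^ (q / 2) * q : ℤ)) : ZMod p) ∧
      ¬ (p : ℤ) ∣ ((q : ℤ) - 1) * (((q : ℤ) + 1) ^ 2 - V₀.LFunction q ^ 2) := by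
  obtain ⟨σ, hσcl, hσ1, hσ2⟩ := exists_galois_transfer_of_irr V₀ p hp57 hirr
  exact exists_transferPrime_of_galois V₀ p hσcl hσ1 hσ2

end Summit.BirchSwinnertonDyer.BirchSwinnertonDyer.Theorems.LTwistTransfer

end
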